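/-
Literature/ModelTheory/ExponentialFields/RealAbelianNumbers.lean
-/
import Mathlib.FieldTheory.IntermediateField.Adjoin.Basic
import Mathlib.RingTheory.RootsOfUnity.Complex
import Mathlib.Algebra.Algebra.Hom.Rat
import HarnessLib

/-!
# The real abelian numbers `ℚ^{abℝ} ⊆ ℂ` (Kirby–Macintyre–Onshuus)

Kirby, Macintyre and Onshuus [KMO, §2.1] work in an exponential field `F` whose kernel
`{x | E x = 1}` is infinite cyclic, with generators `±τ`.  Such an `F` contains the group `U` of all
roots of unity (`E (j τ / n)`, `j < n`, are `n` distinct `n`-th roots of `1`), hence the field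
`ℚ^{ab} = ℚ(U) = ℚ[U]`.  Every involution of `Aut(ℚ^{alg})` restricts on `ℚ^{ab}` to one and the same
involution `σ₀`, characterised by `σ₀ u = u⁻¹` for all `u ∈ U`, and KMO *define* the
**real abelian numbers** as `ℚ^{abℝ} := Fix(σ₀)` [KMO, §2.1, p. 3]; they note that `ℚ^{abℝ}` is also
the unique maximal formally real subfield of `ℚ^{ab}`, and `ℚ^{ab} ∩ ℚ^{tr}`.  KMO Theorem 1: every
real abelian number is pointwise definable in every such `F` (proof, §2.7: a real abelian number is
`∑ rₙ cos (2π sₙ)` with `rₙ ∈ ℤ`, `sₙ ∈ ℚ`); Theorem 2: in Zilber's fields no other algebraic number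
is definable.

This file realises the notion INSIDE `ℂ` (the case `F = ℂ_exp`, `τ = 2πi`).  There `σ₀` is the
restriction of complex conjugation to `ℚ^{ab}` (`conj u = u⁻¹` for `u ∈ U`,
`conj_eq_inv_of_mem_rootsOfUnitySet`), so `Fix(σ₀) = ℚ^{ab} ∩ ℝ`, which is the definition we take:

* `rootsOfUnitySet`    — `U = {z : ℂ | ∃ n > 0, z ^ n = 1}`;
* `abelianNumbers`     — `ℚ^{ab} := ℚ(U)`, an `IntermediateField ℚ ℂ`;
* `realAbelianNumbers` — `ℚ^{abℝ} := ℚ(U) ⊓ ℝ`, an `IntermediateField ℚ ℂ`.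

API:
* `mem_abelianNumbers_iff` : `x ∈ ℚ^{ab} ↔ ∃ n > 0, x ∈ ℚ(exp (2πi/n))` (`ℚ(U) = ⋃ₙ ℚ(ζₙ)`);
* `mem_realAbelianNumbers_iff` : the set-builder form
  `x.im = 0 ∧ ∃ n, 0 < n ∧ x ∈ ℚ(exp (2πi/n))` used by route `Schanuel/ExceptionalSubspaces`;
* `mem_realAbelianNumbers_iff_conj` : KMO's form `x ∈ ℚ^{ab} ∧ conj x = x` (`Fix(σ₀)`);
* `cos_two_pi_mul_mem_realAbelianNumbers` : `cos (2π q) ∈ ℚ^{abℝ}` for `q : ℚ` [KMO, §2.4, §2.7];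
* `isAlgebraic_of_mem_abelianNumbers`, closure of `ℚ^{ab}` under every ring endomorphism of `ℂ`
  (`map_mem_abelianNumbers`), `conj` fixes `ℚ^{abℝ}` pointwise;
* `apply_eq_self_of_mem_realAbelianNumbers` : every ring endomorphism `j` of `ℂ` commuting with
  `exp` fixes `ℚ^{abℝ}` pointwise — `j (2πi) = ±2πi` (`map_two_pi_I_eq_or_eq_neg`), hence
  `j ζₙ = ζₙ^{±1}` and `j` restricts on `ℚ^{ab}` to `id` or to `conj` (`eqOn_abelianNumbers_id_or_conj`).

Deliberately NOT here: Kronecker–Weber (`ℚ(U)` is the maximal abelian extension of `ℚ` — KMO quote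
it, but neither they nor the routes use it; the definition is by roots of unity); the formally-real
and totally-real characterisations of `ℚ^{abℝ}`; the definability statements KMO Theorems 1–2
(they belong with the exponential-field language files and the routes that cite them).

## References
* [KMO] J. Kirby, A. Macintyre, A. Onshuus, *The algebraic numbers definable in various
  exponential fields*, J. Inst. Math. Jussieu **11** (2012) 825–834, arXiv:1101.4224;
  §2.1 (definition of `ℚ^{ab}`, `σ₀`, `ℚ^{abℝ}`), §2.4 (cosine), §2.7 (proof of Theorem 1).
  Bib key `KirbyMacintyreOnshuus2012`.
-/

noncomputable section

open Complex IntermediateField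
open scoped ComplexConjugate Real

namespace Literature.ModelTheory.ExponentialFields

/-! ### The objects: `U`, `ℚ^{ab}`, `ℚ^{abℝ}` -/

/-- The set `U ⊆ ℂ` of **all complex roots of unity**: `z ^ n = 1` for some `n > 0`
(KMO's group `U`; only the underlying set is needed to generate `ℚ(U)`).
[cite: KirbyMacintyreOnshuus2012, §2.1] -/
def rootsOfUnitySet : Set ℂ := {z : ℂ | ∃ n : ℕ, 0 < n ∧ z ^ n = 1}

/-- The field of **abelian numbers** `ℚ^{ab} := ℚ(U) ⊆ ℂ`: the intermediate field of `ℂ/ℚ`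
generated by all roots of unity (KMO: "`F ⊇ ℚ^{ab} = ℚ(U) = ℚ[U]`, the maximal abelian extension of
`ℚ`" — that `ℚ(U)` is the maximal abelian extension is the Kronecker–Weber theorem, which is
neither used nor asserted here).  See `mem_abelianNumbers_iff` for `ℚ(U) = ⋃ₙ ℚ(e^{2πi/n})`.
[cite: KirbyMacintyreOnshuus2012, §2.1] -/
def abelianNumbers : IntermediateField ℚ ℂ := adjoin ℚ rootsOfUnitySet

/-- The field of **real abelian numbers** `ℚ^{abℝ} := ℚ^{ab} ∩ ℝ ⊆ ℂ`, as an intermediate field of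
`ℂ/ℚ`: `ℚ(U) ⊓ (range of ℝ → ℂ)`.  KMO define `ℚ^{abℝ} := Fix(σ₀)`, `σ₀` the involution of `ℚ^{ab}`
with `σ₀ u = u⁻¹` on roots of unity; inside `ℂ`, `σ₀` is the restriction of complex conjugation
(`conj_eq_inv_of_mem_rootsOfUnitySet`), so `Fix(σ₀) = {x ∈ ℚ^{ab} | conj x = x} = ℚ^{ab} ∩ ℝ`
(`mem_realAbelianNumbers_iff_conj`, `mem_realAbelianNumbers_iff`).
[cite: KirbyMacintyreOnshuus2012, §2.1] -/
def realAbelianNumbers : IntermediateField ℚ ℂ :=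
  abelianNumbers ⊓ Complex.ofRealHom.fieldRange.toIntermediateField fun q => ⟨q, by simp⟩

/-! ### Roots of unity and `ℚ^{ab}` -/

/-- Unfolding lemma for `rootsOfUnitySet`. [folklore] -/
theorem mem_rootsOfUnitySet_iff {z : ℂ} : z ∈ rootsOfUnitySet ↔ ∃ n : ℕ, 0 < n ∧ z ^ n = 1 :=
  Iff.rfl

/-- `ζₙ = exp (2πi/n)` is a root of unity (`n > 0`). [folklore] -/
theorem exp_two_pi_I_div_mem_rootsOfUnitySet {n : ℕ} (hn : 0 < n) :
    exp (2 * π * I / n) ∈ rootsOfUnitySet :=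
  ⟨n, hn, (Complex.isPrimitiveRoot_exp n hn.ne').pow_eq_one⟩

/-- `exp (2πi q)` is a root of unity for every rational `q` (KMO: `E (s τ)`, `s ∈ ℚ`). [folklore] -/
theorem exp_two_pi_I_mul_mem_rootsOfUnitySet (q : ℚ) : exp (2 * π * I * q) ∈ rootsOfUnitySet :=
  ⟨q.den, q.den_pos, (Complex.isPrimitiveRoot_exp_rat q).pow_eq_one⟩

/-- An `n`-th root of unity lies in `ℚ(exp (2πi/n))` (it is a power of `exp (2πi/n)`). [folklore] -/
theorem mem_adjoin_exp_of_pow_eq_one {z : ℂ} {n : ℕ} (hn : 0 < n) (hz : z ^ n = 1) :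
    z ∈ adjoin ℚ {exp (2 * π * I / n)} := by
  haveI : NeZero n := ⟨hn.ne'⟩
  obtain ⟨i, -, rfl⟩ := (Complex.isPrimitiveRoot_exp n hn.ne').eq_pow_of_pow_eq_one hz
  exact pow_mem (mem_adjoin_simple_self ℚ _) i

/-- `U ⊆ ℚ(U) = ℚ^{ab}`. [folklore] -/
theorem rootsOfUnitySet_subset_abelianNumbers : rootsOfUnitySet ⊆ abelianNumbers :=
  subset_adjoin ℚ _

/-- A root of unity is an abelian number. [folklore] -/
theorem mem_abelianNumbers_of_pow_eq_one {z : ℂ} {n : ℕ} (hn : 0 < n) (hz : z ^ n = 1) :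
    z ∈ abelianNumbers :=
  rootsOfUnitySet_subset_abelianNumbers ⟨n, hn, hz⟩

/-- `exp (2πi q) ∈ ℚ^{ab}` for rational `q`. [folklore] -/
theorem exp_two_pi_I_mul_mem_abelianNumbers (q : ℚ) : exp (2 * π * I * q) ∈ abelianNumbers :=
  rootsOfUnitySet_subset_abelianNumbers (exp_two_pi_I_mul_mem_rootsOfUnitySet q)

/-- `ℚ(exp (2πi/n)) ≤ ℚ^{ab}` for `n > 0`. [folklore] -/
theorem adjoin_exp_le_abelianNumbers {n : ℕ} (hn : 0 < n) :
    adjoin ℚ {exp (2 * π * I / n)} ≤ abelianNumbers :=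
  adjoin_le_iff.mpr
    (Set.singleton_subset_iff.mpr
      (rootsOfUnitySet_subset_abelianNumbers (exp_two_pi_I_div_mem_rootsOfUnitySet hn)))

/-- **`ℚ(U) = ⋃ₙ ℚ(ζₙ)`**: `x` is an abelian number iff `x ∈ ℚ(exp (2πi/n))` for some `n > 0`
(finitely many roots of unity of orders `n₁, …, n_k` all lie in `ℚ(exp (2πi/N))`, `N = ∏ nᵢ`).
[folklore] -/
theorem mem_abelianNumbers_iff {x : ℂ} :
    x ∈ abelianNumbers ↔ ∃ n : ℕ, 0 < n ∧ x ∈ adjoin ℚ {exp (2 * π * I / n)} := by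
  constructor
  · intro hx
    obtain ⟨T, hTU, hxT⟩ := exists_finset_of_mem_adjoin hx
    have H : ∀ z : ℂ, z ∈ rootsOfUnitySet → ∃ n : ℕ, 0 < n ∧ z ^ n = 1 := fun z hz => hz
    choose! ord hord_pos hord_pow using H
    have hN : 0 < ∏ t ∈ T, ord t := Finset.prod_pos fun t ht => hord_pos t (hTU ht)
    refine ⟨∏ t ∈ T, ord t, hN, ?_⟩
    refine (adjoin_le_iff.mpr ?_ : adjoin ℚ (T : Set ℂ) ≤ adjoin ℚ {exp (2 * π * I / _)}) hxT
    intro t ht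
    obtain ⟨m, hm⟩ := Finset.dvd_prod_of_mem ord (Finset.mem_coe.mp ht)
    refine mem_adjoin_exp_of_pow_eq_one hN ?_
    rw [hm, pow_mul, hord_pow t (hTU ht), one_pow]
  · rintro ⟨n, hn, hx⟩
    exact adjoin_exp_le_abelianNumbers hn hx

/-- Roots of unity are integral over `ℚ`. [folklore] -/
theorem isIntegral_of_mem_rootsOfUnitySet {z : ℂ} (hz : z ∈ rootsOfUnitySet) : IsIntegral ℚ z := by
  obtain ⟨n, hn, hzn⟩ := hz
  exact ⟨Polynomial.X ^ n - 1, Polynomial.monic_X_pow_sub_C 1 hn.ne', by simp [hzn]⟩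

/-- `ℚ^{ab}/ℚ` is algebraic. [folklore] -/
instance isAlgebraic_abelianNumbers : Algebra.IsAlgebraic ℚ abelianNumbers :=
  isAlgebraic_adjoin fun _ hz => isIntegral_of_mem_rootsOfUnitySet hz

/-- Abelian numbers are algebraic. [folklore] -/
theorem isAlgebraic_of_mem_abelianNumbers {x : ℂ} (hx : x ∈ abelianNumbers) : IsAlgebraic ℚ x :=
  IntermediateField.isAlgebraic_iff.mp (isAlgebraic_abelianNumbers.isAlgebraic ⟨x, hx⟩)

/-- A ring endomorphism of `ℂ` maps roots of unity to roots of unity. [folklore] -/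
theorem map_mem_rootsOfUnitySet (f : ℂ →+* ℂ) {u : ℂ} (hu : u ∈ rootsOfUnitySet) :
    f u ∈ rootsOfUnitySet := by
  obtain ⟨n, hn, hun⟩ := hu
  exact ⟨n, hn, by rw [← map_pow, hun, map_one]⟩

/-- A ring endomorphism of `ℂ` maps `ℚ^{ab}` into itself. [folklore] -/
theorem map_mem_abelianNumbers (f : ℂ →+* ℂ) {x : ℂ} (hx : x ∈ abelianNumbers) :
    f x ∈ abelianNumbers := by
  have hle : (abelianNumbers.map f.toRatAlgHom : IntermediateField ℚ ℂ) ≤ abelianNumbers := by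
    rw [abelianNumbers, adjoin_map]
    refine adjoin.mono ℚ _ _ ?_
    rintro _ ⟨u, hu, rfl⟩
    exact map_mem_rootsOfUnitySet f hu
  refine hle ?_
  rw [← SetLike.mem_coe, coe_map]
  exact ⟨x, hx, rfl⟩

/-- On roots of unity complex conjugation is inversion, `conj u = u⁻¹`: the restriction of `conj` to
`ℚ^{ab} = ℚ(U)` is KMO's involution `σ₀`. [cite: KirbyMacintyreOnshuus2012, §2.1] -/
theorem conj_eq_inv_of_mem_rootsOfUnitySet {u : ℂ} (hu : u ∈ rootsOfUnitySet) : conj u = u⁻¹ := by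
  obtain ⟨n, hn, hun⟩ := hu
  have habs : ‖u‖ = 1 := by
    have h := congrArg norm hun
    rw [norm_pow, norm_one] at h
    exact (pow_eq_one_iff_of_nonneg (norm_nonneg u) hn.ne').mp h
  exact (Complex.inv_eq_conj habs).symm

/-- `ℚ^{ab}` is stable under complex conjugation (`σ₀`-stability). [folklore] -/
theorem conj_mem_abelianNumbers {x : ℂ} (hx : x ∈ abelianNumbers) : conj x ∈ abelianNumbers :=
  map_mem_abelianNumbers (starRingEnd ℂ) hx

/-! ### Membership in `ℚ^{abℝ}` -/

/-- `ℚ^{abℝ} ≤ ℚ^{ab}`. [folklore] -/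
theorem realAbelianNumbers_le_abelianNumbers : realAbelianNumbers ≤ abelianNumbers := inf_le_left

/-- `x ∈ ℚ^{abℝ} ↔ x ∈ ℚ^{ab} ∧ im x = 0` (`ℚ^{abℝ} = ℚ^{ab} ∩ ℝ`).
[cite: KirbyMacintyreOnshuus2012, §2.1] -/
theorem mem_realAbelianNumbers_iff_mem_and_im {x : ℂ} :
    x ∈ realAbelianNumbers ↔ x ∈ abelianNumbers ∧ x.im = 0 := by
  rw [realAbelianNumbers, mem_inf]
  refine and_congr_right' ?_
  change x ∈ Complex.ofRealHom.fieldRange ↔ _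
  rw [RingHom.mem_fieldRange]
  exact ⟨by rintro ⟨r, rfl⟩; exact ofReal_im r,
    fun h => ⟨x.re, Complex.ext (by simp) (by simp [h])⟩⟩

/-- **Membership in `ℚ^{abℝ}`, set-builder form** (the form inlined in route
`Schanuel/ExceptionalSubspaces`): `x ∈ ℚ^{abℝ} ↔ im x = 0 ∧ ∃ n > 0, x ∈ ℚ(exp (2πi/n))`.
[cite: KirbyMacintyreOnshuus2012, §2.1] -/
theorem mem_realAbelianNumbers_iff {x : ℂ} :
    x ∈ realAbelianNumbers ↔
      x.im = 0 ∧ ∃ n : ℕ, 0 < n ∧ x ∈ adjoin ℚ ({exp (2 * π * I / n)} : Set ℂ) := by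
  rw [mem_realAbelianNumbers_iff_mem_and_im, mem_abelianNumbers_iff, and_comm]

/-- **KMO's definition `ℚ^{abℝ} = Fix(σ₀)`**: `x ∈ ℚ^{abℝ} ↔ x ∈ ℚ^{ab} ∧ conj x = x`.
[cite: KirbyMacintyreOnshuus2012, §2.1] -/
theorem mem_realAbelianNumbers_iff_conj {x : ℂ} :
    x ∈ realAbelianNumbers ↔ x ∈ abelianNumbers ∧ conj x = x := by
  rw [mem_realAbelianNumbers_iff_mem_and_im, conj_eq_iff_im]

/-- Elements of `ℚ^{abℝ}` are real. [folklore] -/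
theorem im_eq_zero_of_mem_realAbelianNumbers {x : ℂ} (hx : x ∈ realAbelianNumbers) : x.im = 0 :=
  (mem_realAbelianNumbers_iff_mem_and_im.mp hx).2

/-- Elements of `ℚ^{abℝ}` are algebraic. [folklore] -/
theorem isAlgebraic_of_mem_realAbelianNumbers {x : ℂ} (hx : x ∈ realAbelianNumbers) :
    IsAlgebraic ℚ x :=
  isAlgebraic_of_mem_abelianNumbers (realAbelianNumbers_le_abelianNumbers hx)

/-- Complex conjugation fixes `ℚ^{abℝ}` pointwise. [folklore] -/
theorem conj_eq_self_of_mem_realAbelianNumbers {x : ℂ} (hx : x ∈ realAbelianNumbers) : conj x = x :=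
  (mem_realAbelianNumbers_iff_conj.mp hx).2

/-- `ℚ^{abℝ}` is closed under complex conjugation (trivially: `conj` fixes it). [folklore] -/
theorem conj_mem_realAbelianNumbers_iff {x : ℂ} :
    conj x ∈ realAbelianNumbers ↔ x ∈ realAbelianNumbers := by
  constructor
  · intro h
    have h' := conj_eq_self_of_mem_realAbelianNumbers h
    rw [Complex.conj_conj] at h'
    rw [h']
    exact h
  · intro h
    rwa [conj_eq_self_of_mem_realAbelianNumbers h]

/-- A real number `r` is real abelian iff `(r : ℂ) ∈ ℚ^{ab}`. [folklore] -/
theorem ofReal_mem_realAbelianNumbers_iff {r : ℝ} :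
    (r : ℂ) ∈ realAbelianNumbers ↔ (r : ℂ) ∈ abelianNumbers := by
  rw [mem_realAbelianNumbers_iff_mem_and_im, ofReal_im, and_iff_left rfl]

/-- **Special values of cosine are real abelian**: `cos (2π q) ∈ ℚ^{abℝ}` for `q : ℚ`
(`cos (2π q) = (E(qτ) + E(-qτ))/2`, KMO §2.4, §2.7). [cite: KirbyMacintyreOnshuus2012, §2.7] -/
theorem cos_two_pi_mul_mem_realAbelianNumbers (q : ℚ) :
    (Real.cos (2 * π * q) : ℂ) ∈ realAbelianNumbers := by
  rw [ofReal_mem_realAbelianNumbers_iff, Complex.ofReal_cos]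
  have h2 : (Real.cos (2 * π * q) : ℂ) = Complex.cos (2 * π * q) := by push_cast; rfl
  rw [Complex.cos]
  push_cast
  refine div_mem (add_mem ?_ ?_) (ofNat_mem abelianNumbers 2)
  · have h := exp_two_pi_I_mul_mem_abelianNumbers q
    convert h using 2
    ring
  · have h := exp_two_pi_I_mul_mem_abelianNumbers (-q)
    convert h using 2
    push_cast
    ring

/-! ### Ring endomorphisms of `ℂ` commuting with `exp` fix `ℚ^{abℝ}` pointwise -/

/-- Two ring endomorphisms of `ℂ` that agree on `S` agree on `ℚ(S)`. [folklore] -/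
theorem eqOn_adjoin_of_eqOn {f g : ℂ →+* ℂ} {S : Set ℂ} (h : Set.EqOn f g S) :
    Set.EqOn f g (adjoin ℚ S) := by
  intro x hx
  have hx' : x ∈ Subfield.closure (Set.range (algebraMap ℚ ℂ) ∪ S) := hx
  refine RingHom.eqOn_field_closure ?_ hx'
  rintro y (⟨q, rfl⟩ | hy)
  · simp
  · exact h hy

section ExpEndomorphism

variable {j : ℂ →+* ℂ}

/-- A ring endomorphism `j` of `ℂ` commuting with `exp` maps `2πi` to `±2πi`: `j (2πi) = 2πi k`
lies in the kernel `2πiℤ`, and `|k| ≥ 2` (or `k = 0`) would give `j (exp (2πi/|k|)) = 1`,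
contradicting injectivity of `j`. [folklore] -/
theorem map_two_pi_I_eq_or_eq_neg (hj : ∀ z : ℂ, j (exp z) = exp (j z)) :
    j (2 * π * I) = 2 * π * I ∨ j (2 * π * I) = -(2 * π * I) := by
  have h1 : exp (j (2 * π * I)) = 1 := by rw [← hj, Complex.exp_two_pi_mul_I, map_one]
  obtain ⟨k, hk⟩ := Complex.exp_eq_one_iff.mp h1
  have hinj := j.injective
  obtain ⟨m, hm⟩ : ∃ m : ℕ, k = m ∨ k = -m := ⟨k.natAbs, Int.natAbs_eq k⟩
  have hm1 : m = 1 := by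
    by_contra hm1
    rcases Nat.eq_zero_or_pos m with rfl | hmpos
    · have h0 : j (2 * π * I) = 0 := by rcases hm with rfl | rfl <;> simp [hk]
      exact Complex.two_pi_I_ne_zero (hinj (h0.trans (map_zero j).symm))
    · have hm2 : 1 < m := lt_of_le_of_ne hmpos (Ne.symm hm1)
      have hζ := Complex.isPrimitiveRoot_exp m hmpos.ne'
      refine hζ.ne_one hm2 (hinj ?_)
      rw [map_one, hj, map_div₀, map_natCast, hk, Complex.exp_eq_one_iff]
      have hm0 : (m : ℂ) ≠ 0 := by exact_mod_cast hmpos.ne'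
      rcases hm with rfl | rfl
      · exact ⟨1, by push_cast; field_simp⟩
      · exact ⟨-1, by push_cast; field_simp⟩
  subst hm1
  rcases hm with rfl | rfl
  · left
    simpa using hk
  · right
    simpa using hk

/-- `j (exp (2πi/n)) = exp (j (2πi) / n)` for an `exp`-commuting ring endomorphism `j`. [folklore] -/
theorem map_exp_two_pi_I_div (hj : ∀ z : ℂ, j (exp z) = exp (j z)) (n : ℕ) :
    j (exp (2 * π * I / n)) = exp (j (2 * π * I) / n) := by
  rw [hj, map_div₀, map_natCast]

/-- `conj (exp (2πi/n)) = exp (-(2πi)/n)` (`σ₀ ζₙ = ζₙ⁻¹`). [folklore] -/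
theorem conj_exp_two_pi_I_div (n : ℕ) :
    conj (exp (2 * π * I / n)) = exp (-(2 * π * I) / n) := by
  rw [← Complex.exp_conj, map_div₀, map_natCast, map_mul, map_mul, Complex.conj_I,
    Complex.conj_ofReal, map_ofNat, mul_neg]

/-- **Dichotomy.** A ring endomorphism of `ℂ` commuting with `exp` restricts on `ℚ^{ab}` either to
the identity (`j (2πi) = 2πi`, `j ζₙ = ζₙ`) or to complex conjugation (`j (2πi) = -2πi`,
`j ζₙ = ζₙ⁻¹ = conj ζₙ`). [folklore] -/
theorem eqOn_abelianNumbers_id_or_conj (hj : ∀ z : ℂ, j (exp z) = exp (j z)) :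
    Set.EqOn j (RingHom.id ℂ) abelianNumbers ∨ Set.EqOn j (starRingEnd ℂ) abelianNumbers := by
  rcases map_two_pi_I_eq_or_eq_neg hj with h | h
  · left
    intro x hx
    obtain ⟨n, hn, hxn⟩ := mem_abelianNumbers_iff.mp hx
    refine eqOn_adjoin_of_eqOn ?_ hxn
    intro z hz
    rw [Set.mem_singleton_iff] at hz
    subst hz
    rw [map_exp_two_pi_I_div hj, h, RingHom.id_apply]
  · right
    intro x hx
    obtain ⟨n, hn, hxn⟩ := mem_abelianNumbers_iff.mp hx
    refine eqOn_adjoin_of_eqOn ?_ hxn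
    intro z hz
    rw [Set.mem_singleton_iff] at hz
    subst hz
    rw [map_exp_two_pi_I_div hj, h, conj_exp_two_pi_I_div]

/-- **Exponential ring endomorphisms of `ℂ` fix the real abelian numbers pointwise**: if
`j : ℂ →+* ℂ` satisfies `j ∘ exp = exp ∘ j` then `j x = x` for every `x ∈ ℚ^{abℝ}` (on `ℚ^{ab}`,
`j` is `id` or `conj`, and `conj` fixes `ℚ^{abℝ}`).  This is the `ℂ`-instance of the mechanism behind
KMO Theorem 1 (real abelian numbers are fixed by every automorphism because they are definable).
[folklore] -/
theorem apply_eq_self_of_mem_realAbelianNumbers (hj : ∀ z : ℂ, j (exp z) = exp (j z)) {x : ℂ}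
    (hx : x ∈ realAbelianNumbers) : j x = x := by
  obtain ⟨hxa, hxc⟩ := mem_realAbelianNumbers_iff_conj.mp hx
  rcases eqOn_abelianNumbers_id_or_conj hj with h | h
  · exact h hxa
  · exact (h hxa).trans hxc

/-- Set form: an `exp`-commuting ring endomorphism of `ℂ` is the identity on `ℚ^{abℝ}`. [folklore] -/
theorem eqOn_id_realAbelianNumbers (hj : ∀ z : ℂ, j (exp z) = exp (j z)) :
    Set.EqOn j id realAbelianNumbers := fun _ hx =>
  apply_eq_self_of_mem_realAbelianNumbers hj hx

end ExpEndomorphism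

end Literature.ModelTheory.ExponentialFields
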